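import Literature.NumberTheory.EllipticCurves.EtaQuotientQExpansionProofs
import HarnessLib

/-!
# `q`-asymptotics at `i∞` from vanishing `q`-expansion coefficients (toward (T1)–(T3) at level 27)

Cell bsd-f2-manin, route `ManinLocalTwoThree`.  The fact-free `|c| = 1` on `X₀(27)` is reduced
(`EtaIdentityReduction.abs_maninConstant_eq_one_twentySeven_of_tendsto`) to three limits at `i∞` of
explicit combinations of `η`-products.  This file supplies the generic tool turning VANISHING OF THE
FIRST `q`-EXPANSION COEFFICIENTS of a `1`-periodic holomorphic bounded function into decay at `i∞`
(plain-function version of the tree's `isBigO_exp_of_qExpansion_coeff_eq_zero` for modular forms), the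
division form `f/q^m → 0`, and the first instances for the Euler functions `E_δ = ∏ (1 − q^{δn})`
(`eulerFn`): the coefficients of `E_δ` vanish off the multiples of `δ`, so `(E_δ − 1)/q^{δ−1} → 0`.
-/

set_option autoImplicit false
set_option linter.dupNamespace false

noncomputable section

open Complex Filter Topology Set Asymptotics PowerSeries
open UpperHalfPlane hiding I
open scoped Real Topology Manifold MatrixGroups
open Literature.NumberTheory.EllipticCurves Literature.NumberTheory.EllipticCurves.ModularForms

namespace Summit.BirchSwinnertonDyer.BirchSwinnertonDyer.Theorems.ManinLocalTwoThree.EtaAsymptotics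

/-- **Vanishing of the first `m` `q`-coefficients gives decay `O(e^{−2πm Im τ})`** for a `1`-periodic
holomorphic function bounded at `i∞` (the cusp function has a zero of order `≥ m` at `q = 0`).
[folklore] -/
theorem isBigO_exp_of_qExpansion_coeff_eq_zero {f : ℍ → ℂ}
    (hper : Function.Periodic (f ∘ ofComplex) 1) (hmd : MDifferentiable 𝓘(ℂ) 𝓘(ℂ) f)
    (hbd : IsBoundedAtImInfty f) {m : ℕ} (hf : ∀ i < m, (qExpansion 1 f).coeff i = 0) :
    f =O[atImInfty] fun τ : ℍ ↦ Real.exp (-2 * π * m * τ.im) := by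
  have han : AnalyticAt ℂ (cuspFunction 1 f) 0 := analyticAt_cuspFunction_zero one_pos hper hmd hbd
  have hord : (m : ℕ∞) ≤ analyticOrderAt (cuspFunction 1 f) 0 := by
    rw [natCast_le_analyticOrderAt_iff_iteratedDeriv_eq_zero han]
    intro i hi
    have := hf i hi
    rw [qExpansion_coeff] at this
    simpa [Nat.factorial_ne_zero] using this
  obtain ⟨G, hG, hfG⟩ := (natCast_le_analyticOrderAt han).mp hord
  obtain ⟨C, hC⟩ : ∃ C, ∀ᶠ z in 𝓝 (0 : ℂ), ‖G z‖ ≤ C :=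
    ⟨‖G 0‖ + 1, hG.continuousAt.norm.eventually (eventually_le_nhds (lt_add_one _))⟩
  have hev : ∀ᶠ z in 𝓝 (0 : ℂ), ‖cuspFunction 1 f z‖ ≤ C * ‖z ^ m‖ := by
    filter_upwards [hfG, hC] with z hz hz'
    rw [hz, sub_zero, norm_smul, mul_comm]
    gcongr
  have hq := (qParam_tendsto_atImInfty one_pos).eventually hev
  refine IsBigO.of_bound C ?_
  filter_upwards [hq] with τ hτ
  rw [UpperHalfPlane.eq_cuspFunction τ one_ne_zero hper] at hτ
  refine hτ.trans (le_of_eq ?_)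
  rw [norm_pow, Function.Periodic.norm_qParam, UpperHalfPlane.coe_im, ← Real.exp_nat_mul,
    Real.norm_eq_abs, Real.abs_exp]
  congr 1
  ring

/-- **Division form**: if the `q`-coefficients `0, …, m` vanish then `f(τ)/q^m → 0` at `i∞`.
[folklore] -/
theorem tendsto_div_qParam_pow_of_qExpansion_coeff_eq_zero {f : ℍ → ℂ}
    (hper : Function.Periodic (f ∘ ofComplex) 1) (hmd : MDifferentiable 𝓘(ℂ) 𝓘(ℂ) f)
    (hbd : IsBoundedAtImInfty f) {m : ℕ} (hf : ∀ i ≤ m, (qExpansion 1 f).coeff i = 0) :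
    Tendsto (fun τ : ℍ ↦ f τ / Function.Periodic.qParam 1 (τ : ℂ) ^ m) atImInfty (𝓝 0) := by
  have hO := isBigO_exp_of_qExpansion_coeff_eq_zero hper hmd hbd (m := m + 1)
    (fun i hi ↦ hf i (Nat.lt_succ_iff.mp hi))
  obtain ⟨C, hC⟩ := hO.bound
  have hexp : Tendsto (fun τ : ℍ ↦ C * Real.exp (-2 * π * τ.im)) atImInfty (𝓝 0) := by
    have h1 : Tendsto (fun τ : ℍ ↦ Real.exp (-2 * π * τ.im)) atImInfty (𝓝 0) := by
      refine Real.tendsto_exp_atBot.comp ?_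
      have := (tendsto_comap (f := UpperHalfPlane.im)).const_mul_atTop_of_neg
        (show -2 * π < 0 by linarith [Real.pi_pos])
      exact this
    simpa using h1.const_mul C
  refine squeeze_zero_norm' ?_ hexp
  filter_upwards [hC] with τ hτ
  have hqpos : 0 < ‖Function.Periodic.qParam 1 (τ : ℂ)‖ ^ m := by
    rw [Function.Periodic.norm_qParam]; positivity
  rw [norm_div, norm_pow, div_le_iff₀ hqpos]
  refine hτ.trans (le_of_eq ?_)
  rw [Real.norm_eq_abs, Real.abs_exp, Function.Periodic.norm_qParam, UpperHalfPlane.coe_im,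
    ← Real.exp_nat_mul]
  have hsplit : Real.exp (-2 * π * ((m + 1 : ℕ) : ℝ) * τ.im)
      = Real.exp (-2 * π * τ.im) * Real.exp ((m : ℕ) * (-2 * π * τ.im / 1)) := by
    rw [← Real.exp_add]
    congr 1
    push_cast
    ring
  rw [hsplit, mul_assoc]
  ring

/-! ## The Euler functions `E_δ = ∏ (1 − q^{δn})` -/

/-- The `q`-coefficients of `E_δ` vanish off the multiples of `δ`. [folklore] -/
theorem qExpansion_eulerFn_coeff_of_not_dvd {δ i : ℕ} (hδ : 0 < δ) (hi : ¬ δ ∣ i) :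
    (qExpansion 1 (eulerFn δ)).coeff i = 0 := by
  rw [qExpansion_eulerFn hδ, coeff_map, coeff_formalEulerScaled, if_neg hi, map_zero]

/-- The `q`-coefficients `0 ≤ i < δ` of `E_δ − 1` vanish. [folklore] -/
theorem qExpansion_eulerFn_sub_one_coeff {δ i : ℕ} (hδ : 0 < δ) (hi : i < δ) :
    (qExpansion 1 (eulerFn δ - 1)).coeff i = 0 := by
  have han := (isIntUnitQExp_eulerFn hδ).analyticAt
  have h1 : AnalyticAt ℂ (cuspFunction 1 (1 : ℍ → ℂ)) 0 := IsIntUnitQExp.one.analyticAt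
  rw [qExpansion_sub han h1, map_sub, qExpansion_one]
  rcases Nat.eq_zero_or_pos i with rfl | hi0
  · rw [PowerSeries.coeff_zero_eq_constantCoeff, sub_eq_zero,
      ← PowerSeries.coeff_zero_eq_constantCoeff_apply, (isIntUnitQExp_eulerFn hδ).coeff_zero, map_one]
  · rw [PowerSeries.coeff_one, if_neg hi0.ne', sub_zero]
    exact qExpansion_eulerFn_coeff_of_not_dvd hδ (Nat.not_dvd_of_pos_of_lt hi0 hi)

/-- **`(E_δ − 1)/q^{δ−1} → 0` at `i∞`**, i.e. `E_δ = 1 + O(q^δ)`. [folklore] -/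
theorem tendsto_eulerFn_sub_one_div_qParam_pow {δ : ℕ} (hδ : 0 < δ) :
    Tendsto (fun τ : ℍ ↦ (eulerFn δ τ - 1) / Function.Periodic.qParam 1 (τ : ℂ) ^ (δ - 1))
      atImInfty (𝓝 0) := by
  have hper : Function.Periodic ((eulerFn δ - 1) ∘ ofComplex) 1 := fun z ↦ by
    have := periodic_eulerFn δ z
    simp only [Function.comp_apply, Pi.sub_apply, Pi.one_apply] at this ⊢
    rw [this]
  have hmd : MDifferentiable 𝓘(ℂ) 𝓘(ℂ) (eulerFn δ - 1) :=
    (mdifferentiable_eulerFn δ).sub mdifferentiable_const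
  have hbd : IsBoundedAtImInfty (eulerFn δ - 1) :=
    (isBoundedAtImInfty_eulerFn hδ).sub (const_boundedAtFilter atImInfty (1 : ℂ))
  have h := tendsto_div_qParam_pow_of_qExpansion_coeff_eq_zero hper hmd hbd (m := δ - 1)
    (fun i hi ↦ qExpansion_eulerFn_sub_one_coeff hδ (by omega))
  exact h

/-- `E₉ = 1 + O(q⁹)`: `(E₉ − 1)/q⁸ → 0` at `i∞`. [folklore] -/
theorem tendsto_eulerFn_nine_sub_one :
    Tendsto (fun τ : ℍ ↦ (eulerFn 9 τ - 1) / Function.Periodic.qParam 1 (τ : ℂ) ^ 8)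
      atImInfty (𝓝 0) :=
  tendsto_eulerFn_sub_one_div_qParam_pow (δ := 9) (by norm_num)

/-- `E₂₇ = 1 + O(q²⁷)`: `(E₂₇ − 1)/q²⁶ → 0` at `i∞`. [folklore] -/
theorem tendsto_eulerFn_twentySeven_sub_one :
    Tendsto (fun τ : ℍ ↦ (eulerFn 27 τ - 1) / Function.Periodic.qParam 1 (τ : ℂ) ^ 26)
      atImInfty (𝓝 0) :=
  tendsto_eulerFn_sub_one_div_qParam_pow (δ := 27) (by norm_num)

/-- The `q`-coefficients `1, 2, 4, 5, 7, 8` of `E₃` vanish. [folklore] -/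
theorem qExpansion_eulerFn_three_coeff_of_not_dvd {i : ℕ} (hi : ¬ 3 ∣ i) :
    (qExpansion 1 (eulerFn 3)).coeff i = 0 :=
  qExpansion_eulerFn_coeff_of_not_dvd (by norm_num) hi

/-- The `q`-coefficient `3` of `E₃` is `−1` (`∏ (1 − Xⁿ) = 1 − X − X² + ⋯`). [folklore] -/
theorem qExpansion_eulerFn_three_coeff_three : (qExpansion 1 (eulerFn 3)).coeff 3 = -1 := by
  rw [qExpansion_eulerFn (by norm_num : 0 < 3), coeff_map, coeff_formalEulerScaled,
    if_pos (dvd_refl 3), Nat.div_self (by norm_num : 0 < 3), coeff_formalEulerPow (le_refl 1),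
    eulerTrunc, Finset.prod_range_one, zero_add, pow_one, pow_one, map_sub, coeff_one, coeff_X]
  simp

end Summit.BirchSwinnertonDyer.BirchSwinnertonDyer.Theorems.ManinLocalTwoThree.EtaAsymptotics

end
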